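import Literature.AnabelianGeometry.EtaleTheta.Discharge.Sec3Cor38iiiWeak
import Literature.AlgebraicGeometry.Frobenioids.EquivalenceFrobeniusQuasiIsotropic
import Literature.AlgebraicGeometry.Frobenioids.ModelFrobenioidTypeBridge
import Literature.AlgebraicGeometry.Frobenioids.IsoSubanchorNotIsotropic

/-!

**WEAK-VOCABULARY TWIN (part 3 of the (K) port, abc-iut cell, F-L2d2-1 / F-L2d2-2 repair chain, seat
abc-iut-L2-d2).**  This file is `Discharge/Sec3Cor38iiiFSM.lean` with the realified base data typed over
`treeMonoidVocabWeak` (`FrdIVocabularyWeak.lean`: "perf-factorial" := `IsPerfFactorialCof`, weakly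
perf-factorial with cofinal perfection — the reading needed at tempered coverings with infinitely many
special-fibre components, `Ÿ`, `Z_∞`, where the printed [FrdI] Def. 2.4 (i)(d) fails) instead of
`treeMonoidVocab`; every declaration carries the suffix `_weak` and the tempered Frobenioid `C` as an
explicit binder; the proofs are unchanged (the only use of perf-factoriality is "`Φ(A)` is divisorial",
read through `IsPerfFactorialCof → IsPerfFactorialWeak → IsDivisorial`).  Original docstring follows.

# [EtTh] Corollary 3.8 (iii), first clause, over bases of FSM-type: the [FrdI] Thm 3.4 (ii)/(iii)
# inputs DISCHARGED by L1's proved theorems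

Mochizuki, *The étale theta function …*, Publ. RIMS **45** (2009), Cor. 3.8 (iii), PDF p.81
[cite: MochizukiEtTh2009, Cor 3.8 p.81]; proof p.82: "by Theorem 3.7, (i), (ii), `C₁`, `C₂` are of
standard and isotropic type, but not of group-like type. In particular, by [Mzk17], Theorem 3.4, (ii);
[Mzk17], Theorem 4.2, (i), it follows that `Ψ` preserves pre-steps and primary steps."

abc-iut cell, layer L2, node `EtTh:Cor3.8(iii)`, sequel of `Sec3Cor38iii.lean` (theorems only): when
the base categories `D₁`, `D₂` are of FSM-type (the cell's repaired hypothesis for [FrdI] Thm 3.4 —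
print has FSMFF; [EtTh] Rmk 3.7.2: "`D₀` is … of FSM-, hence also of FSMFF-, type") and the model
Frobenioids `C_i → F_{Φ_i}` are Frobenioids ([FrdI] Thm 5.2 (ii), hypotheses `hF₁`, `hF₂`), the inputs
"`Ψ`, `Ψ⁻¹` preserve pre-steps and morphisms of Frobenius type" of `cor38_iii_of_weak` are THEOREMS:
abc-iut-L1-t13's `FrdI.thm34ii_of_isOfFSMType` / `FrdI.thm34iii_morphisms_of_isOfFSMType`
(quasi-isotropic type from Thm 3.7 (i) "isotropic" = L1 `ModelFrobenioid.data_isOfIsotropicType` +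
[FrdI] Rmk 3.1.1; a non-group-like object from Thm 3.7 (i) "not of group-like type" =
abc-iut-L6-t13's `thm37_i_not_groupLike`; `Φ_i` non-dilating from `Cor38Hyp`).  What remains explicit:
[FrdI] Thm 4.2 (i) ("`Ψ` preserves primary steps": `hprim`, `hprim'`, abc-iut-L1-t14's `Thm42Sub`
chain) and the Def. 3.1 support axioms `hD1`/`hDa`/`hDn`/`hDc` (interface finding).
HONEST FRAMING: refereed pre-IUT material; nothing here bears on [IUTchIII] Cor. 3.12.
-/

namespace Literature.AnabelianGeometry.EtaleTheta

open CategoryTheory Opposite Literature.AlgebraicGeometry.Frobenioids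

universe u₀ v₀ u v w

variable {D₀ : Type u₀} [Category.{v₀} D₀] {T : RealifiedDivisorMonoids (D₀ := D₀) treeMonoidVocabWeak.{w}}
  {D : Type u} [Category.{v} D] {VD : FrdICatStub.{u, v, w} D}

namespace TemperedFrobenioid

/-- Thm 3.7 (i) ⟹ the hypothesis "of quasi-isotropic type" of L1's FSM-type form of [FrdI] Thm 3.4: the
model Frobenioid of a tempered Frobenioid is of isotropic (L1 `ModelFrobenioid.data_isOfIsotropicType`),
hence — being a Frobenioid — of quasi-isotropic type ([FrdI] Rmk 3.1.1). [cite: MochizukiEtTh2009, Thm 3.7 p.79] -/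
theorem data_isOfQuasiIsotropicType_weak (C : TemperedFrobenioid T D VD) (hF : PreFrobenioid.IsFrobenioid C.toElem) :
    (PreFrobenioidData.ofFunctor C.divisorMonoid C.toElem).IsOfQuasiIsotropicType :=
  isOfQuasiIsotropicType_of_isOfIsotropicType _ _ hF
    (ModelFrobenioid.data_isOfIsotropicType C.objectwise_isGroupLike_weak)

/-- "`Φ` non-dilating" (the standing hypothesis of Cor 3.8, in `Cor38Hyp`) in the operations language of
L1's Thm 3.4 files. [cite: MochizukiEtTh2009, Cor 3.8 p.80] -/
theorem data_isNonDilatingOn_weak (C : TemperedFrobenioid T D VD)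
    (hnd : ∀ (A : Dᵒᵖ) (f : A ⟶ A), treeMonoidVocabWeak.IsNonDilating (C.Φ.carrier A) (C.Φ.pull f)) :
    (PreFrobenioidData.ofFunctor C.divisorMonoid C.toElem).IsNonDilatingOn :=
  (ModelFrobenioid.data_isNonDilatingOn_iff _ _ _).2 fun A α => hnd (op A) α.op

/-- Thm 3.7 (i) "not of group-like type" (abc-iut-L6-t13's `thm37_i_not_groupLike`) ⟹ the hypothesis
"a non-group-like object exists" of L1's Thm 3.4 (iii). [cite: MochizukiEtTh2009, Thm 3.7 p.79] -/
theorem exists_not_isGroupLikeObj_weak (C : TemperedFrobenioid T D VD) :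
    ∃ A : C.category, ¬ (PreFrobenioidData.ofFunctor C.divisorMonoid C.toElem).IsGroupLikeObj A :=
  not_forall.1 C.thm37_i_not_groupLike

end TemperedFrobenioid

section FSM

variable {D₀' : Type u₀} [Category.{v₀} D₀'] {T' : RealifiedDivisorMonoids (D₀ := D₀') treeMonoidVocabWeak.{w}}
  {D' : Type u} [Category.{v} D'] {VD' : FrdICatStub.{u, v, w} D'}

open TemperedFrobenioid

/-- **[EtTh] Corollary 3.8 (iii), first clause, over FSM-type bases**: for tempered Frobenioids whose
model Frobenioids are Frobenioids ([FrdI] Thm 5.2 (ii)) over base categories of FSM-type, abc-iut-L2-t3's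
`Cor38_iii h` holds modulo [FrdI] Thm 4.2 (i) (`hprim`, `hprim'`) and the Def. 3.1 support axioms —
"`Ψ` preserves pre-steps" and "`Ψ` preserves morphisms of Frobenius type" being L1's PROVED
`FrdI.thm34ii_of_isOfFSMType` / `FrdI.thm34iii_morphisms_of_isOfFSMType` applied to `Ψ` and `Ψ⁻¹`.
[cite: MochizukiEtTh2009, Cor 3.8 p.81] -/
theorem cor38_iii_of_isOfFSMType_weak {C₁ : TemperedFrobenioid T D VD} {C₂ : TemperedFrobenioid T' D' VD'} (h : Cor38Hyp C₁ C₂)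
    (hF₁ : PreFrobenioid.IsFrobenioid C₁.toElem) (hF₂ : PreFrobenioid.IsFrobenioid C₂.toElem)
    (hD : IsOfFSMType D) (hD' : IsOfFSMType D')
    (hprim : ∀ ⦃X Y : C₁.category⦄ (φ : X ⟶ Y), PreFrobenioid.IsPrimaryPreStep C₁.toElem φ →
      PreFrobenioid.IsPrimaryPreStep C₂.toElem (h.Ψ.functor.map φ))
    (hprim' : ∀ ⦃X Y : C₂.category⦄ (φ : X ⟶ Y), PreFrobenioid.IsPrimaryPreStep C₂.toElem φ →
      PreFrobenioid.IsPrimaryPreStep C₁.toElem (h.Ψ.inverse.map φ))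
    (hD1₁ : ∀ (A : Dᵒᵖ) (y : C₁.Φ.carrier A), C₁.IsBaseFieldTheoreticDiv y → C₁.IsNonCuspidal y)
    (hDa₁ : ∀ (A : Dᵒᵖ) (x : C₁.Φ.carrier A), C₁.IsNonCuspidal x → C₁.IsCuspidal x → x = 1)
    (hDn₁ : ∀ (A : Dᵒᵖ) (x : C₁.Φ.carrier A),
      C₁.IsNonCuspidal x ↔ ∀ y : C₁.Φ.carrier A, IsPrimary y → Precsim y x → C₁.IsNonCuspidal y)
    (hDc₁ : ∀ (A : Dᵒᵖ) (x : C₁.Φ.carrier A),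
      C₁.IsCuspidal x ↔ ∀ y : C₁.Φ.carrier A, IsPrimary y → Precsim y x → C₁.IsCuspidal y)
    (hD1₂ : ∀ (A : D'ᵒᵖ) (y : C₂.Φ.carrier A), C₂.IsBaseFieldTheoreticDiv y → C₂.IsNonCuspidal y)
    (hDa₂ : ∀ (A : D'ᵒᵖ) (x : C₂.Φ.carrier A), C₂.IsNonCuspidal x → C₂.IsCuspidal x → x = 1)
    (hDn₂ : ∀ (A : D'ᵒᵖ) (x : C₂.Φ.carrier A),
      C₂.IsNonCuspidal x ↔ ∀ y : C₂.Φ.carrier A, IsPrimary y → Precsim y x → C₂.IsNonCuspidal y)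
    (hDc₂ : ∀ (A : D'ᵒᵖ) (x : C₂.Φ.carrier A),
      C₂.IsCuspidal x ↔ ∀ y : C₂.Φ.carrier A, IsPrimary y → Precsim y x → C₂.IsCuspidal y) :
    Cor38_iii h := by
  have hq₁ := C₁.data_isOfQuasiIsotropicType_weak hF₁
  have hq₂ := C₂.data_isOfQuasiIsotropicType_weak hF₂
  have hnd₁ := C₁.data_isNonDilatingOn_weak h.nonDilating.1
  have hnd₂ := C₂.data_isNonDilatingOn_weak h.nonDilating.2
  have hN₁ := C₁.exists_not_isGroupLikeObj_weak
  have hN₂ := C₂.exists_not_isGroupLikeObj_weak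
  -- [FrdI] Thm 3.4 (ii)/(iii) over FSM-type bases, for `Ψ` and for `Ψ⁻¹ = Ψ.symm`
  have h2 := FrdI.thm34ii_of_isOfFSMType hF₁ hF₂ hq₁ hq₂ hD hD' h.Ψ
  have h2' := FrdI.thm34ii_of_isOfFSMType hF₂ hF₁ hq₂ hq₁ hD' hD h.Ψ.symm
  have h3 := FrdI.thm34iii_morphisms_of_isOfFSMType hF₁ hF₂ hq₁ hq₂ hD hD' hnd₁ hnd₂ h.Ψ hN₁ hN₂
  have h3' := FrdI.thm34iii_morphisms_of_isOfFSMType hF₂ hF₁ hq₂ hq₁ hD' hD hnd₂ hnd₁ h.Ψ.symm hN₂ hN₁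
  refine cor38_iii_of_weak h (fun X Y φ hφ => h2.1 φ hφ) (fun X Y φ hφ => h2'.1 φ hφ) hprim hprim'
    (fun X Y φ hφ => ?_) (fun X Y φ hφ => ?_) hD1₁ hDa₁ hDn₁ hDc₁ hD1₂ hDa₂ hDn₂ hDc₂
  · exact (PreFrobenioidData.ofFunctor_isFrobeniusType C₂.toElem _).1
      (h3.1.1 φ ((PreFrobenioidData.ofFunctor_isFrobeniusType C₁.toElem φ).2 hφ))
  · exact (PreFrobenioidData.ofFunctor_isFrobeniusType C₁.toElem _).1
      (h3'.1.1 φ ((PreFrobenioidData.ofFunctor_isFrobeniusType C₂.toElem φ).2 hφ))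

end FSM

end Literature.AnabelianGeometry.EtaleTheta
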